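import Summits.Ventures.Crystal3D.Bulk.CapX2BoxW062P11hi
import Summits.Ventures.Crystal3D.Bulk.CapX2BoxW062P12hi
import Summits.Ventures.Crystal3D.Bulk.CapX2BoxW062P13hi
import Summits.Ventures.Crystal3D.Bulk.CapX2BoxW062P22hi
import Summits.Ventures.Crystal3D.Bulk.CapX2BoxW062P23hi000
import Summits.Ventures.Crystal3D.Bulk.CapX2BoxW062P23hi001
import Summits.Ventures.Crystal3D.Bulk.CapX2BoxW062P23hi010
import Summits.Ventures.Crystal3D.Bulk.CapX2BoxW062P23hi011
import Summits.Ventures.Crystal3D.Bulk.CapX2BoxW062P23hi100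
import Summits.Ventures.Crystal3D.Bulk.CapX2BoxW062P23hi101
import Summits.Ventures.Crystal3D.Bulk.CapX2BoxW062P23hi110
import Summits.Ventures.Crystal3D.Bulk.CapX2BoxW062P23hi111
import Summits.Ventures.Crystal3D.Bulk.CapX2BoxW062P33hi
import Summits.Ventures.Crystal3D.Bulk.CapX2BoxW062T111
import Summits.Ventures.Crystal3D.Bulk.CapX2BoxW062T112
import Summits.Ventures.Crystal3D.Bulk.CapX2BoxW062T122
import Summits.Ventures.Crystal3D.Bulk.CapX2BoxW062T222
import Summits.Ventures.Crystal3D.Bulk.CapX2BoxW062A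
import Summits.Ventures.Crystal3D.Bulk.CapX2CertW062I
import HarnessLib

/-!
# Inequalities (II) and (III) of the X2 certificate `w62_d12_dX12_u062` by compiled evaluation ⇒ `NoHole 0.62`

Venture `Crystal3D` (cell `pub-crystal3d`, phase 2; seat typer-bulk; certificate: seat idea-2, level `-0.62`,
transcribed by seat p1 as `CapX2.certW062` with (N) and (I) in the kernel, `CapX2CertW062I.lean`:
`noHole_062_of_certW062' : IneqII → IneqIII → NoHole 0.62`). The two residual hypotheses — (II) `P + λ ≤ 0` on
`[-0.62,1]² × [-1,1/2] ∩ {Gram ≥ 0}` (dense tensor of degrees `(12,12,24)`) and (III) `S₃ - ε₃ ≤ 0` on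
`[-1,1/2]³ ∩ {Gram ≥ 0}` (degree `12`) — are discharged by 54 Boolean evaluations of the S-procedure
tensor-Bernstein check `Bern.checkPos3S` (`CapBoxSproc.lean`; soundness on the standard axioms), one per file
`CapX2BoxW062P….lean` / `CapX2BoxW062T….lean` (part A `CapX2BoxW062A.lean` holds the `t ≤ -1/4` cells), on sub-boxes that cover the half `u ≤ v` of p1's
`ineqII_of_forall_pairPolyZ` (coarse ranges `r₁ = [u₀, 0.19]`, `r₂ = [0.19, 0.6]`, `r₃ = [0.6, 1]`, `t` split at
`-1/4`; the slow cells halved again in each variable) and the sorted region `a ≤ b ≤ d` of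
`ineqIII_of_forall_tripleZ` (halves of `[-1,1/2]` at `-1/4`).

TRUST BASE: the `native_decide` evaluations (compiled checker trusted — the class of the tree's `KissingSearch`
parts); everything else kernel-checked on `[propext, Classical.choice, Quot.sound]`. So `noHole_062` —
**`ρ* < arccos 0.62 = 51.6838656°`, the top of `W⁶`** — is a tree theorem of COMPUTATIONAL grade; the third,
code-disjoint implementation of this certificate's (II)/(III) check (after idea-2 `x2cert`, theory-2 `capx2cert`,
+ ref-2 replay) and the first inside the proof assistant. HONEST FRAMING: no census is asserted.
-/

open Literature.Geometry.DiscreteGeometry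

namespace Summit.Ventures.Crystal3D.CapX2

/-- From a `true` (III) check on a sub-box: `S₃ - ε₃ ≤ 0` at its admissible points. [folklore] -/
theorem tripleZ_W062_nonpos_of_check (lo0 hi0 lo1 hi1 lo2 hi2 : ℚ)
    (h : CapCut.Bern.checkPos3S (CapCut.Bern.pad3 12 (scale3 (-1) (tripleZ certW062 eps3W062))) 12
      lo0 hi0 lo1 hi1 lo2 hi2 80 40 64 = true) (a b d : ℝ)
    (ha0 : (lo0 : ℝ) ≤ a) (ha1 : a ≤ hi0) (hb0 : (lo1 : ℝ) ≤ b) (hb1 : b ≤ hi1) (hd0 : (lo2 : ℝ) ≤ d)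
    (hd1 : d ≤ hi2) (hg : 0 ≤ 1 + 2 * a * b * d - a ^ 2 - b ^ 2 - d ^ 2) :
    eval3 (tripleZ certW062 eps3W062) a b d ≤ 0 := by
  have h' := CapCut.Bern.nonneg_of_checkPos3S _ 12 lo0 hi0 lo1 hi1 lo2 hi2 80 40 64 h a b d
    ha0 ha1 hb0 hb1 hd0 hd1 hg
  rw [CapCut.Bern.eval3_pad3, CapCut.Bern.eval3_eq_capX2_eval3, eval3_scale3] at h'
  push_cast at h'
  linarith

/-- (II) on coarse cell `11hi` (with `u ≤ v`). [folklore] -/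
theorem cell_11hi_W062 (u v t : ℝ) (huv : u ≤ v) (hu0 : ((-31 / 50) : ℝ) ≤ u) (hu1 : u ≤ (19 / 100)) (hv0 : ((-31 / 50) : ℝ) ≤ v)
    (hv1 : v ≤ (19 / 100)) (ht0 : ((-1 / 4) : ℝ) ≤ t) (ht1 : t ≤ (1 / 2))
    (hg : 0 ≤ 1 + 2 * u * v * t - u ^ 2 - v ^ 2 - t ^ 2) : eval3 (pairPolyZ certW062 lamW062) u v t ≤ 0 := by
  have _h := And.intro huv (And.intro hu0 (And.intro hu1 (And.intro hv0 (And.intro hv1 (And.intro ht0 ht1)))))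
  exact pairPolyZ_W062_nonpos_of_check (-31 / 50) (19 / 100) (-31 / 50) (19 / 100) (-1 / 4) (1 / 2) checkII_11hi_W062 u v t (by push_cast; linarith) (by push_cast; linarith) (by push_cast; linarith) (by push_cast; linarith) (by push_cast; linarith) (by push_cast; linarith) hg

/-- (II) on coarse cell `12hi` (with `u ≤ v`). [folklore] -/
theorem cell_12hi_W062 (u v t : ℝ) (huv : u ≤ v) (hu0 : ((-31 / 50) : ℝ) ≤ u) (hu1 : u ≤ (19 / 100)) (hv0 : ((19 / 100) : ℝ) ≤ v)
    (hv1 : v ≤ (3 / 5)) (ht0 : ((-1 / 4) : ℝ) ≤ t) (ht1 : t ≤ (1 / 2))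
    (hg : 0 ≤ 1 + 2 * u * v * t - u ^ 2 - v ^ 2 - t ^ 2) : eval3 (pairPolyZ certW062 lamW062) u v t ≤ 0 := by
  have _h := And.intro huv (And.intro hu0 (And.intro hu1 (And.intro hv0 (And.intro hv1 (And.intro ht0 ht1)))))
  exact pairPolyZ_W062_nonpos_of_check (-31 / 50) (19 / 100) (19 / 100) (3 / 5) (-1 / 4) (1 / 2) checkII_12hi_W062 u v t (by push_cast; linarith) (by push_cast; linarith) (by push_cast; linarith) (by push_cast; linarith) (by push_cast; linarith) (by push_cast; linarith) hg

/-- (II) on coarse cell `13hi` (with `u ≤ v`). [folklore] -/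
theorem cell_13hi_W062 (u v t : ℝ) (huv : u ≤ v) (hu0 : ((-31 / 50) : ℝ) ≤ u) (hu1 : u ≤ (19 / 100)) (hv0 : ((3 / 5) : ℝ) ≤ v)
    (hv1 : v ≤ 1) (ht0 : ((-1 / 4) : ℝ) ≤ t) (ht1 : t ≤ (1 / 2))
    (hg : 0 ≤ 1 + 2 * u * v * t - u ^ 2 - v ^ 2 - t ^ 2) : eval3 (pairPolyZ certW062 lamW062) u v t ≤ 0 := by
  have _h := And.intro huv (And.intro hu0 (And.intro hu1 (And.intro hv0 (And.intro hv1 (And.intro ht0 ht1)))))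
  exact pairPolyZ_W062_nonpos_of_check (-31 / 50) (19 / 100) (3 / 5) 1 (-1 / 4) (1 / 2) checkII_13hi_W062 u v t (by push_cast; linarith) (by push_cast; linarith) (by push_cast; linarith) (by push_cast; linarith) (by push_cast; linarith) (by push_cast; linarith) hg

/-- (II) on coarse cell `22hi` (with `u ≤ v`). [folklore] -/
theorem cell_22hi_W062 (u v t : ℝ) (huv : u ≤ v) (hu0 : ((19 / 100) : ℝ) ≤ u) (hu1 : u ≤ (3 / 5)) (hv0 : ((19 / 100) : ℝ) ≤ v)
    (hv1 : v ≤ (3 / 5)) (ht0 : ((-1 / 4) : ℝ) ≤ t) (ht1 : t ≤ (1 / 2))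
    (hg : 0 ≤ 1 + 2 * u * v * t - u ^ 2 - v ^ 2 - t ^ 2) : eval3 (pairPolyZ certW062 lamW062) u v t ≤ 0 := by
  have _h := And.intro huv (And.intro hu0 (And.intro hu1 (And.intro hv0 (And.intro hv1 (And.intro ht0 ht1)))))
  exact pairPolyZ_W062_nonpos_of_check (19 / 100) (3 / 5) (19 / 100) (3 / 5) (-1 / 4) (1 / 2) checkII_22hi_W062 u v t (by push_cast; linarith) (by push_cast; linarith) (by push_cast; linarith) (by push_cast; linarith) (by push_cast; linarith) (by push_cast; linarith) hg

/-- (II) on coarse cell `23hi` (with `u ≤ v`). [folklore] -/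
theorem cell_23hi_W062 (u v t : ℝ) (huv : u ≤ v) (hu0 : ((19 / 100) : ℝ) ≤ u) (hu1 : u ≤ (3 / 5)) (hv0 : ((3 / 5) : ℝ) ≤ v)
    (hv1 : v ≤ 1) (ht0 : ((-1 / 4) : ℝ) ≤ t) (ht1 : t ≤ (1 / 2))
    (hg : 0 ≤ 1 + 2 * u * v * t - u ^ 2 - v ^ 2 - t ^ 2) : eval3 (pairPolyZ certW062 lamW062) u v t ≤ 0 := by
  have _h := And.intro huv (And.intro hu0 (And.intro hu1 (And.intro hv0 (And.intro hv1 (And.intro ht0 ht1)))))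
  by_cases ht : t ≤ ((1 / 8) : ℝ)
  · by_cases hvm : v ≤ ((4 / 5) : ℝ)
    · by_cases hum : u ≤ ((79 / 200) : ℝ)
      · exact pairPolyZ_W062_nonpos_of_check (19 / 100) (79 / 200) (3 / 5) (4 / 5) (-1 / 4) (1 / 8) checkII_23hi_000_W062 u v t (by push_cast; linarith) (by push_cast; linarith) (by push_cast; linarith) (by push_cast; linarith) (by push_cast; linarith) (by push_cast; linarith) hg
      · push Not at hum
        exact pairPolyZ_W062_nonpos_of_check (79 / 200) (3 / 5) (3 / 5) (4 / 5) (-1 / 4) (1 / 8) checkII_23hi_100_W062 u v t (by push_cast; linarith) (by push_cast; linarith) (by push_cast; linarith) (by push_cast; linarith) (by push_cast; linarith) (by push_cast; linarith) hg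
    · push Not at hvm
      by_cases hum : u ≤ ((79 / 200) : ℝ)
      · exact pairPolyZ_W062_nonpos_of_check (19 / 100) (79 / 200) (4 / 5) 1 (-1 / 4) (1 / 8) checkII_23hi_010_W062 u v t (by push_cast; linarith) (by push_cast; linarith) (by push_cast; linarith) (by push_cast; linarith) (by push_cast; linarith) (by push_cast; linarith) hg
      · push Not at hum
        exact pairPolyZ_W062_nonpos_of_check (79 / 200) (3 / 5) (4 / 5) 1 (-1 / 4) (1 / 8) checkII_23hi_110_W062 u v t (by push_cast; linarith) (by push_cast; linarith) (by push_cast; linarith) (by push_cast; linarith) (by push_cast; linarith) (by push_cast; linarith) hg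
  · push Not at ht
    by_cases hvm : v ≤ ((4 / 5) : ℝ)
    · by_cases hum : u ≤ ((79 / 200) : ℝ)
      · exact pairPolyZ_W062_nonpos_of_check (19 / 100) (79 / 200) (3 / 5) (4 / 5) (1 / 8) (1 / 2) checkII_23hi_001_W062 u v t (by push_cast; linarith) (by push_cast; linarith) (by push_cast; linarith) (by push_cast; linarith) (by push_cast; linarith) (by push_cast; linarith) hg
      · push Not at hum
        exact pairPolyZ_W062_nonpos_of_check (79 / 200) (3 / 5) (3 / 5) (4 / 5) (1 / 8) (1 / 2) checkII_23hi_101_W062 u v t (by push_cast; linarith) (by push_cast; linarith) (by push_cast; linarith) (by push_cast; linarith) (by push_cast; linarith) (by push_cast; linarith) hg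
    · push Not at hvm
      by_cases hum : u ≤ ((79 / 200) : ℝ)
      · exact pairPolyZ_W062_nonpos_of_check (19 / 100) (79 / 200) (4 / 5) 1 (1 / 8) (1 / 2) checkII_23hi_011_W062 u v t (by push_cast; linarith) (by push_cast; linarith) (by push_cast; linarith) (by push_cast; linarith) (by push_cast; linarith) (by push_cast; linarith) hg
      · push Not at hum
        exact pairPolyZ_W062_nonpos_of_check (79 / 200) (3 / 5) (4 / 5) 1 (1 / 8) (1 / 2) checkII_23hi_111_W062 u v t (by push_cast; linarith) (by push_cast; linarith) (by push_cast; linarith) (by push_cast; linarith) (by push_cast; linarith) (by push_cast; linarith) hg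

/-- (II) on coarse cell `33hi` (with `u ≤ v`). [folklore] -/
theorem cell_33hi_W062 (u v t : ℝ) (huv : u ≤ v) (hu0 : ((3 / 5) : ℝ) ≤ u) (hu1 : u ≤ 1) (hv0 : ((3 / 5) : ℝ) ≤ v)
    (hv1 : v ≤ 1) (ht0 : ((-1 / 4) : ℝ) ≤ t) (ht1 : t ≤ (1 / 2))
    (hg : 0 ≤ 1 + 2 * u * v * t - u ^ 2 - v ^ 2 - t ^ 2) : eval3 (pairPolyZ certW062 lamW062) u v t ≤ 0 := by
  have _h := And.intro huv (And.intro hu0 (And.intro hu1 (And.intro hv0 (And.intro hv1 (And.intro ht0 ht1)))))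
  exact pairPolyZ_W062_nonpos_of_check (3 / 5) 1 (3 / 5) 1 (-1 / 4) (1 / 2) checkII_33hi_W062 u v t (by push_cast; linarith) (by push_cast; linarith) (by push_cast; linarith) (by push_cast; linarith) (by push_cast; linarith) (by push_cast; linarith) hg

/-- **Inequality (II) of `certW062`** (the coarse cells cover the half `u ≤ v`). [folklore] -/
theorem certW062_ineqII : certW062.IneqII (1 / 2) lamW062 :=
  ineqII_of_forall_pairPolyZ certW062 (1 / 2) lamW062 fun u v t hu huv hv1 ht0 ht1 hg => by
    rw [certW062_u0] at hu
    have hu' : (-31 / 50 : ℝ) ≤ u := by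
      have h0 : (((-31 / 50 : ℚ)) : ℝ) ≤ u := by exact_mod_cast hu
      push_cast at h0; linarith
    have e : ((1 / 2 : ℚ) : ℝ) = 1 / 2 := by push_cast; ring
    have ht1' : t ≤ 1 / 2 := by rw [← e]; exact ht1
    by_cases ht : t ≤ (-1 / 4 : ℝ)
    · by_cases hv2 : v ≤ (19 / 100 : ℝ)
      · exact cell_11lo_W062 u v t huv (by linarith) (by linarith) (by linarith) (by linarith) (by linarith) (by linarith) hg
      · push Not at hv2
        by_cases hv3 : v ≤ (3 / 5 : ℝ)
        · by_cases hu2 : u ≤ (19 / 100 : ℝ)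
          · exact cell_12lo_W062 u v t huv (by linarith) (by linarith) (by linarith) (by linarith) (by linarith) (by linarith) hg
          · push Not at hu2
            exact cell_22lo_W062 u v t huv (by linarith) (by linarith) (by linarith) (by linarith) (by linarith) (by linarith) hg
        · push Not at hv3
          by_cases hu2 : u ≤ (19 / 100 : ℝ)
          · exact cell_13lo_W062 u v t huv (by linarith) (by linarith) (by linarith) (by linarith) (by linarith) (by linarith) hg
          · push Not at hu2
            by_cases hu3 : u ≤ (3 / 5 : ℝ)
            · exact cell_23lo_W062 u v t huv (by linarith) (by linarith) (by linarith) (by linarith) (by linarith) (by linarith) hg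
            · push Not at hu3
              exact cell_33lo_W062 u v t huv (by linarith) (by linarith) (by linarith) (by linarith) (by linarith) (by linarith) hg
    · push Not at ht
      by_cases hv2 : v ≤ (19 / 100 : ℝ)
      · exact cell_11hi_W062 u v t huv (by linarith) (by linarith) (by linarith) (by linarith) (by linarith) (by linarith) hg
      · push Not at hv2
        by_cases hv3 : v ≤ (3 / 5 : ℝ)
        · by_cases hu2 : u ≤ (19 / 100 : ℝ)
          · exact cell_12hi_W062 u v t huv (by linarith) (by linarith) (by linarith) (by linarith) (by linarith) (by linarith) hg
          · push Not at hu2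
            exact cell_22hi_W062 u v t huv (by linarith) (by linarith) (by linarith) (by linarith) (by linarith) (by linarith) hg
        · push Not at hv3
          by_cases hu2 : u ≤ (19 / 100 : ℝ)
          · exact cell_13hi_W062 u v t huv (by linarith) (by linarith) (by linarith) (by linarith) (by linarith) (by linarith) hg
          · push Not at hu2
            by_cases hu3 : u ≤ (3 / 5 : ℝ)
            · exact cell_23hi_W062 u v t huv (by linarith) (by linarith) (by linarith) (by linarith) (by linarith) (by linarith) hg
            · push Not at hu3
              exact cell_33hi_W062 u v t huv (by linarith) (by linarith) (by linarith) (by linarith) (by linarith) (by linarith) hg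

/-- **Inequality (III) of `certW062`** (four sorted sub-boxes cover `a ≤ b ≤ d`). [folklore] -/
theorem certW062_ineqIII : certW062.IneqIII (1 / 2) eps3W062 :=
  ineqIII_of_forall_tripleZ certW062 (1 / 2) eps3W062 fun a b d ha hab hbd hd hg => by
    have e : ((1 / 2 : ℚ) : ℝ) = 1 / 2 := by push_cast; ring
    have hd2 : d ≤ 1 / 2 := by rw [← e]; exact hd
    by_cases hd4 : d ≤ (-1 / 4 : ℝ)
    · exact tripleZ_W062_nonpos_of_check (-1) (-1 / 4) (-1) (-1 / 4) (-1) (-1 / 4) checkIII_111_W062 a b d (by push_cast; linarith) (by push_cast; linarith) (by push_cast; linarith) (by push_cast; linarith) (by push_cast; linarith) (by push_cast; linarith) hg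
    · push Not at hd4
      by_cases hb4 : b ≤ (-1 / 4 : ℝ)
      · exact tripleZ_W062_nonpos_of_check (-1) (-1 / 4) (-1) (-1 / 4) (-1 / 4) (1 / 2) checkIII_112_W062 a b d (by push_cast; linarith) (by push_cast; linarith) (by push_cast; linarith) (by push_cast; linarith) (by push_cast; linarith) (by push_cast; linarith) hg
      · push Not at hb4
        by_cases ha4 : a ≤ (-1 / 4 : ℝ)
        · exact tripleZ_W062_nonpos_of_check (-1) (-1 / 4) (-1 / 4) (1 / 2) (-1 / 4) (1 / 2) checkIII_122_W062 a b d (by push_cast; linarith) (by push_cast; linarith) (by push_cast; linarith) (by push_cast; linarith) (by push_cast; linarith) (by push_cast; linarith) hg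
        · push Not at ha4
          exact tripleZ_W062_nonpos_of_check (-1 / 4) (1 / 2) (-1 / 4) (1 / 2) (-1 / 4) (1 / 2) checkIII_222_W062 a b d (by push_cast; linarith) (by push_cast; linarith) (by push_cast; linarith) (by push_cast; linarith) (by push_cast; linarith) (by push_cast; linarith) hg

/-- **`NoHole 0.62`**: twelve pairwise `≥ 60°`-separated directions on `S²` leave no empty cap of angular radius
`≥ arccos 0.62 = 51.6838656°` (top of `W⁶`). Computational grade (one native axiom per piece file). [folklore] -/
theorem noHole_062 : NoHole 0.62 := noHole_062_of_certW062' certW062_ineqII certW062_ineqIII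

/-- **GAP(1.26) from the census of `W⁶` alone** (census socket, threshold `1.24`). [folklore] -/
theorem noHole_063_of_forall_censusRows_062
    (hkill : ∀ c : Fin 14 → EuclideanSpace ℝ (Fin 3), CensusRows c → (1.24 : ℝ) ≤ intruderDist c → False) :
    NoHole 0.63 :=
  noHole_063_of_certW062_of_forall_censusRows' certW062_ineqII certW062_ineqIII hkill

/-- **Window form**: `ExtremalFreeWindow 1.24 1.26 → NoHole 0.63`. [folklore] -/
theorem noHole_063_of_window_124 (hwin : ExtremalFreeWindow 1.24 1.26) : NoHole 0.63 :=
  noHole_063_of_certW062_of_window' certW062_ineqII certW062_ineqIII hwin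

end Summit.Ventures.Crystal3D.CapX2
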